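import Mathlib.FieldTheory.RatFunc.AsPolynomial
import Literature.IUT.HodgeTheaters.KappaCoricGalois
import HarnessLib

/-!
# [IUTchI] Remark 3.1.7 (iii): the characterisation of `κ`-solvable elements — PROOF

S. Mochizuki, *Inter-universal Teichmüller theory I*, §3, Remark 3.1.7 (iii) (kurims final
manuscript May 2020, p. 68) [claim: Mochizuki2012, status: disputed]. PROOF-ONLY companion of
`Literature/IUT/HodgeTheaters/KappaCoricGalois.lean` (statement module, abc-iut-L5-t2); no new
definitions.

The printed claim "an element `f ∈ L̄_C` is `κ`-solvable if and only if there exists a positive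
integer `n` such that `fⁿ` is a `∞κ×`-coric element of `F_sol·L_C`" is typed there as
`CriticalLocus.KappaSolvableIff S Λ Fsol f` for an ARBITRARY parameter set `Fsol ⊆ Ω` standing for
`F_sol^×`. The bare `Prop` is false for a general `Fsol` (witness: `Λ = Ω(t)`, `Fsol = {2}`,
`f = 2 = 2·1` is `κ`-solvable since the constant `1` is `κ`-coric, but no `2·fⁿ = 2ⁿ⁺¹` has a
`κ`-coric power, `2` not being a root of unity). In print `F_sol` is the maximal SOLVABLE extension
of `F_mod`, so `F_sol^×` is a group closed under extraction of `n`-th roots; we discharge the claim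
under exactly these closure hypotheses on `Fsol` (inverses, powers, `n`-th roots), for every field
`Λ ⊇ Ω(t)`:

* `CriticalLocus.kappaSolvableIff_of_rootClosed`.

Proof. (⇒) `f = c·g`, `gⁿ = h` `κ`-coric ⟹ `(cⁿ)⁻¹·fⁿ = h`. (⇐) `(c·fⁿ)ᵏ = h` `κ`-coric, `dⁿ = c`
with `d ∈ Fsol` ⟹ `(d·f)ⁿᵏ = h`, so `d·f` is `∞κ`-coric and `f = d⁻¹·(d·f)`. Nothing here bears
on the disputed parts of the series.
-/

namespace Literature.IUT.HodgeTheaters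

open Polynomial
open scoped RatFunc

universe u v

namespace CriticalLocus

variable {Ω : Type u} [Field Ω] [CharZero Ω] (S : CriticalLocus Ω) (Λ : Type v) [Field Λ]
  [Algebra (RatFunc Ω) Λ]

/-- A `κ`-coric rational function is nonzero (it does not vanish at the strictly critical points,
and there is one). [claim: Mochizuki2012, status: disputed] -/
private theorem isKappaCoric_ne_zero {h : RatFunc Ω} (hh : S.IsKappaCoric h) : h ≠ 0 := by
  obtain ⟨e, he⟩ : S.pts.Nonempty := by rw [← Finset.card_pos, S.card_eq]; norm_num
  rintro rfl
  exact hh.avoids.num_eval_ne e he (by rw [RatFunc.num_zero, Polynomial.eval_zero])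

/-- **Rmk 3.1.7 (iii), p. 68, DISCHARGED** under the standing hypotheses on `F_sol^×` (a subgroup of
`Ω^×` closed under `n`-th roots, as the multiplicative group of a solvably closed field is): "an
element `f ∈ L̄_C` is `κ`-solvable if and only if there exists a positive integer `n` such that `fⁿ`
is a `∞κ×`-coric element of `F_sol·L_C`". [claim: Mochizuki2012, status: disputed] -/
theorem kappaSolvableIff_of_rootClosed (Fsol : Set Ω) (hinv : ∀ c ∈ Fsol, c⁻¹ ∈ Fsol)
    (hpow : ∀ c ∈ Fsol, ∀ n : ℕ, c ^ n ∈ Fsol)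
    (hrad : ∀ c ∈ Fsol, ∀ n : ℕ, 0 < n → ∃ d ∈ Fsol, d ^ n = c) (f : Λ) :
    S.KappaSolvableIff Λ Fsol f := by
  have hinj : Function.Injective (algebraMap (RatFunc Ω) Λ) := (algebraMap (RatFunc Ω) Λ).injective
  constructor
  · -- (⇒): `f = c·g`, `gⁿ = h` ⟹ `(cⁿ)⁻¹ · fⁿ = h`
    rintro ⟨c, hc, hc0, g, ⟨n, hn, h, hh, hg⟩, rfl⟩
    refine ⟨n, hn, (c ^ n)⁻¹, hinv _ (hpow c hc n), 1, Nat.one_pos, h, hh, ?_⟩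
    rw [pow_one, mul_pow, ← map_pow, ← map_pow, hg, ← mul_assoc, ← map_mul, ← map_mul, ← map_mul,
      inv_mul_cancel₀ (pow_ne_zero n hc0), map_one, one_mul]
  · -- (⇐): `(c·fⁿ)ᵏ = h`, `dⁿ = c` ⟹ `(d·f)^{n k} = h` and `f = d⁻¹·(d·f)`
    rintro ⟨n, hn, c, hc, k, hk, h, hh, hcf⟩
    have hc0 : c ≠ 0 := by
      rintro rfl
      apply isKappaCoric_ne_zero S hh
      apply hinj
      rw [← hcf, map_zero, map_zero, zero_mul, zero_pow hk.ne']
    obtain ⟨d, hd, hdc⟩ := hrad c hc n hn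
    have hd0 : d ≠ 0 := by rintro rfl; exact hc0 (by rw [← hdc, zero_pow hn.ne'])
    refine ⟨d⁻¹, hinv d hd, inv_ne_zero hd0, algebraMap (RatFunc Ω) Λ (RatFunc.C d) * f,
      ⟨n * k, Nat.mul_pos hn hk, h, hh, ?_⟩, ?_⟩
    · rw [← hcf, pow_mul, mul_pow (algebraMap (RatFunc Ω) Λ (RatFunc.C d)) f n, ← map_pow, ← map_pow,
        hdc]
    · rw [← mul_assoc, ← map_mul, ← map_mul, inv_mul_cancel₀ hd0, map_one, map_one, one_mul]

/-- **Rmk 3.1.7 (iii), p. 68, DISCHARGED** in the owner's restated form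
`KappaSolvableIffRootClosed` (the closure hypotheses on `F_sol^×` folded into the statement,
`KappaCoricGalois.lean` rev. p406573). [claim: Mochizuki2012, status: disputed] -/
theorem kappaSolvableIffRootClosed_holds (Fsol : Set Ω) (f : Λ) :
    S.KappaSolvableIffRootClosed Λ Fsol f :=
  fun hinv hpow hrad => kappaSolvableIff_of_rootClosed S Λ Fsol hinv hpow hrad f

end CriticalLocus

end Literature.IUT.HodgeTheaters
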